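import Mathlib
import Summits.Ventures.CertifiedArithmetic.LowPrec.OptCeilMinimax

/-!
# Opt / R4 — Theorem S9(iii), L∞ part: for a UNIFORM element grid (MXINT8-type, `u • {0,…,127}`) the non-clipping ("ceil") amax rule is NOT minimax-optimal; the floor rule is

HONEST FRAMING: certified error envelopes and provably optimal rounding/accumulation schemes for
low-precision formats under stated cost models; every table by two implementations; no hardware or
vendor claims.

Setting (OPTIMA.md §S, Theorem S9; cost model CM-S of COST-MODELS.md): a block of nonnegative magnitudes
with maximum `a` is stored on a power-of-two-scaled copy of a finite element grid `B ⊆ ℕ`; `err hB s y` is the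
round-to-nearest(-saturating) error of `y` on `s • B` and `blockErr` the block L∞ error
(`OptTwoCandidates.lean`). For the minifloat element grids E2M1 / E2M3 / E3M2, Theorem S5
(`OptCeilMinimax.lean`, `ceil_vs_half_*`, `ceil_minimax_*`) shows that the NON-CLIPPING candidate `2u`
(`T u < a ≤ 2 T u`) is minimax-optimal among amax-only power-of-two rules. Its proof uses a point of the
coincidence zone at which the half grid has error `≥ u`; a UNIFORM grid `{0, 1, …, T}` has no such point
(the half grid `u • {0..T}` has covering radius `u/2` everywhere below its top), and the conclusion FAILS:

* `int8_half_blockErr_lt`: if `127 u < a < 128 u`, EVERY block with entries in `[0, a]` has L∞ error `< u`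
  at the half (clipping) scale `u` (clipping costs `a - 127 u < u`, rounding costs `≤ u/2`);
* `int8_le_ceil_err`: the element `u` has error EXACTLY `≥ u` on the non-clipping grid `(2u) • {0..127}`, so
  the two-element block `(a, u)` has non-clipping L∞ error `≥ u`;
* `int8_ceil_not_minimax`: hence the minimax statement of Theorem S5 (the conclusion of `ceil_vs_half`) is
  FALSE for `B = {0,…,127}`, `T = 127` — witnessed at `k = 2`, `u = 1`, `a = 509/4`;
* `int8_ceil_le_half_of_ge`: conversely, if `128 u ≤ a ≤ 254 u` the non-clipping scale is better than the
  half scale for EVERY block (pointwise, not only minimax): `blockErr (2u) ≤ u ≤ a - 127 u ≤ blockErr u`.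

Together: for the uniform 128-point grid the minimax-optimal amax-only power-of-two rule switches from the
half scale to the non-clipping scale exactly when `a` crosses `128 u`, a power of two times `u` — i.e. it is
the FLOOR rule `X = 2^(⌊log₂ a⌋ - 6)` of the OCP MX v1.0 specification (§6.3) applied to MXINT8 (element
magnitudes `{0,…,127} · 2⁻⁶`; the code `-128` excluded by the symmetric convention of FORMATS.md), and NOT
the ceil rule — OPTIMA.md Theorem S9(iii) (opt seat, pub-lowprec), whose SSE analogue (irrational switch
point `t*(k)`) and constants are certificate C11 (`certs/opt/mxint8_{A,B}.json`, two implementations,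
265 fields, 0 mismatches). Only the L∞ statements are kernel-checked here. The field carries a
`FloorRing` structure (ℚ, ℝ) so that the uniform covering radius can be expressed with `round`.
-/

namespace Summit.Ventures.CertifiedArithmetic.LowPrec.Opt

section Int8

variable {K : Type*} [Field K] [LinearOrder K] [IsStrictOrderedRing K] [FloorRing K]

/-- the MXINT8 magnitude grid `{0, 1, …, 127}` (units of `2⁻⁶`; the scale parameter absorbs the unit) -/
def int8 : Finset ℕ := Finset.range 128

/-- the grid is nonempty (`0 ∈ int8`) -/
theorem int8_ne : int8.Nonempty := ⟨0, by simp [int8]⟩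

/-- membership: `n ∈ int8 ↔ n ≤ 127` -/
theorem mem_int8 {n : ℕ} : n ∈ int8 ↔ n ≤ 127 := by
  simp [int8, Nat.lt_succ_iff]

/-- the top of the grid is `T = 127` -/
theorem int8_le : ∀ n ∈ int8, n ≤ 127 := fun _ hn => mem_int8.mp hn

/-- uniform covering radius: on `[0, 127 u]` the error on `u • {0..127}` is at most `u / 2`
(nearest integer multiple, via `round`). -/
theorem int8_cov {u y : K} (hu : 0 < u) (hy0 : 0 ≤ y) (hy : y ≤ 127 * u) :
    err int8_ne u y ≤ u / 2 := by
  have hr : |y / u - (round (y / u) : ℤ)| ≤ 1 / 2 := abs_sub_round (y / u)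
  rw [abs_le] at hr
  obtain ⟨hr1, hr2⟩ := hr
  have hq0 : 0 ≤ y / u := div_nonneg hy0 hu.le
  have hq1 : y / u ≤ 127 := by rw [div_le_iff₀ hu]; exact hy
  have hz0 : (-1 : K) < (round (y / u) : ℤ) := by linarith
  have hz1 : ((round (y / u) : ℤ) : K) < 128 := by linarith
  have hz0' : (0 : ℤ) ≤ round (y / u) := by
    have : (-1 : ℤ) < round (y / u) := by exact_mod_cast hz0
    omega
  have hz1' : round (y / u) ≤ (127 : ℤ) := by
    have : round (y / u) < (128 : ℤ) := by exact_mod_cast hz1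
    omega
  obtain ⟨n, hn⟩ := Int.eq_ofNat_of_zero_le hz0'
  have hnK : ((round (y / u) : ℤ) : K) = (n : K) := by rw [hn]; push_cast; ring
  have hn127 : n ≤ 127 := by omega
  have hyu : y / u * u = y := div_mul_cancel₀ y hu.ne'
  refine err_le_of_near_abs int8_ne (n := n) (mem_int8.mpr hn127) ?_ ?_
  · rw [← hnK]; nlinarith
  · rw [← hnK]; nlinarith

/-- **S9(iii)-a.** If the maximum satisfies `127 u < a < 128 u`, every block with entries in `[0, a]`
has L∞ error `< u` at the half (clipping) scale `u`. -/
theorem int8_half_blockErr_lt {k : ℕ} (x : Fin k → K) {u a : K} (hu : 0 < u) (hx0 : ∀ i, 0 ≤ x i)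
    (hxa : ∀ i, x i ≤ a) (ha : a < 128 * u) (i₀ : Fin k) :
    blockErr int8_ne u x i₀ < u := by
  unfold blockErr
  rw [Finset.sup'_lt_iff]
  intro i _
  by_cases hy : x i ≤ 127 * u
  · exact (int8_cov hu (hx0 i) hy).trans_lt (by linarith)
  · have hy : 127 * u < x i := lt_of_not_ge hy
    have h := err_le_of_near_abs int8_ne (s := u) (y := x i) (r := a - 127 * u) (n := 127)
      (mem_int8.mpr le_rfl) (by push_cast; linarith [hxa i]) (by push_cast; linarith [hxa i])
    exact h.trans_lt (by linarith)

/-- **S9(iii)-b.** The element `u` is at distance `≥ u` from every point of the non-clipping grid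
`(2u) • {0..127}` (its points are even multiples of `u`). -/
theorem int8_le_ceil_err {u : K} (hu : 0 < u) : u ≤ err int8_ne (2 * u) u := by
  unfold err gridDist
  apply Finset.le_inf'
  intro v hv
  obtain ⟨n, _, rfl⟩ := Finset.mem_image.mp hv
  rcases Nat.eq_zero_or_pos n with h0 | hpos
  · subst h0; simp [abs_of_pos hu]
  · have hn1 : (1 : K) ≤ n := by exact_mod_cast hpos
    rw [abs_of_nonpos (by nlinarith)]
    nlinarith

/-- the two-element witness block `(a, u)` has non-clipping L∞ error `≥ u` -/
theorem int8_ceil_blockErr_ge {u a : K} (hu : 0 < u) :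
    u ≤ blockErr int8_ne (2 * u) ![a, u] 0 := by
  unfold blockErr
  refine le_trans ?_ (Finset.le_sup' (fun i => err int8_ne (2 * u) (![a, u] i)) (Finset.mem_univ 1))
  simpa using int8_le_ceil_err hu

/-- **Theorem S9(iii), L∞: Theorem S5 FAILS for the uniform grid.** The minimax property of the
non-clipping scale (the conclusion of `ceil_vs_half`, here with `B = {0,…,127}`, `T = 127`) is false:
at `u = 1`, `a = 509/4 ∈ (127, 128)` the block `(a, 1)` has non-clipping L∞ error `≥ 1`, while every
block with the same maximum has half-scale L∞ error `< 1`. -/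
theorem int8_ceil_not_minimax :
    ¬ (∀ (k : ℕ) (x : Fin k → K) (u a : K) (i₀ : Fin k), 0 < u → (∀ i, 0 ≤ x i) → (∀ i, x i ≤ a) →
        a ≤ (127 : K) * (2 * u) → (127 : K) * u < a → x i₀ = a →
        ∃ x' : Fin k → K, (∀ i, 0 ≤ x' i) ∧ (∀ i, x' i ≤ a) ∧ x' i₀ = a ∧
          blockErr int8_ne (2 * u) x i₀ ≤ blockErr int8_ne u x' i₀) := by
  intro h
  obtain ⟨x', hx'0, hx'a, _, hle⟩ := h 2 ![(509 / 4 : K), 1] 1 (509 / 4) 0 one_pos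
    (by intro i; fin_cases i <;> norm_num) (by intro i; fin_cases i <;> norm_num)
    (by norm_num) (by norm_num) (by simp)
  have h1 : (1 : K) ≤ blockErr int8_ne (2 * 1) ![(509 / 4 : K), 1] 0 := int8_ceil_blockErr_ge one_pos
  have h2 : blockErr int8_ne (1 : K) x' 0 < 1 :=
    int8_half_blockErr_lt x' one_pos hx'0 hx'a (by norm_num) 0
  linarith

/-- **Theorem S9(iii), L∞, the other side: above the power of two the non-clipping scale wins
pointwise.** If `128 u ≤ a ≤ 254 u` then for EVERY block with entries in `[0, a]` and maximum `a` the
non-clipping error is at most the half-scale error (`≤ u ≤ a - 127 u ≤` clipping error of `a`). -/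
theorem int8_ceil_le_half_of_ge {k : ℕ} (x : Fin k → K) {u a : K} (hu : 0 < u) (hx0 : ∀ i, 0 ≤ x i)
    (hxa : ∀ i, x i ≤ a) (ha : a ≤ (127 : K) * (2 * u)) (ha' : 128 * u ≤ a) (i₀ : Fin k)
    (hi₀ : x i₀ = a) :
    blockErr int8_ne (2 * u) x i₀ ≤ blockErr int8_ne u x i₀ := by
  have hL : blockErr int8_ne (2 * u) x i₀ ≤ u := by
    unfold blockErr
    rw [Finset.sup'_le_iff]
    intro i _
    have := int8_cov (u := 2 * u) (y := x i) (by positivity) (hx0 i) (by linarith [hxa i])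
    linarith
  have hR : u ≤ blockErr int8_ne u x i₀ := by
    have h1 : a - (127 : ℕ) * u ≤ err int8_ne u a := sub_top_le_err int8_ne int8_le hu.le a
    push_cast at h1
    have h2 : err int8_ne u (x i₀) ≤ blockErr int8_ne u x i₀ := by
      unfold blockErr
      exact Finset.le_sup' (fun i => err int8_ne u (x i)) (Finset.mem_univ i₀)
    rw [hi₀] at h2
    linarith
  exact hL.trans hR

end Int8

end Summit.Ventures.CertifiedArithmetic.LowPrec.Opt
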